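import Summits.QuantumFields.YangMills.Theorems.UnitScaleTiltProp8ChartQuadraticFlat
import Summits.QuantumFields.YangMills.Theorems.UnitScaleTiltProp8ChartDoubleBarDeriv
import HarnessLib

/-!
# Route `UnitScaleTilt`, crux K1 «MinimiserStabilityRegPr» (stmt-QuantumFields-19200), stub V2′ `stub_halvingStep` (H), (S3) B3 corollary (★★OWNER ACK 25 (1) (c2)):
# **THE (44)∕(1.33)-TYPE BOUND FOR THE DOUBLE-BAR CHART WITH ITS LINEAR PART WRITTEN OUT** — `‖Q♭(A)(j,c) − (η·Lʲ)·Q_j A(c)‖ ≤ C₂♭·δ²` for `A` of (1.36)∕(152)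
# `w 1`-size `≤ δ < R⋆♭∕4`, k-uniformly (B3 `chartRemainderFlat_hCd_hCq_B1` ∘ CERT-2 `fderiv_chartLogFlat_zero_apply`)

Cell `ym3-torus` (HUMAN RULING D-0037: YM ladder rung R3 — not the Clay problem), width seat `ym-ust-19200-w3` gen 4.  `--supports stmt-QuantumFields-19200 --as helper`;
def-free, 0 sorry.  Print: [Balaban1985Variational] (44) *«Q_j(ηA) = LʲηQ_jA + C_j(LʲηA), |C_j(LʲηA)| ≤ C₂(Lʲη)²|A|²»* for the functional of record (the double-bar
average, [Balaban1985Averaging] Prop. 4); in the cell's level weights `(Lʲη)|A| ≤ δ` this is `‖C♭(A)(j,c)‖ ≤ C₂♭δ²` with `C₂♭ = 64L∕R⋆♭`, `R⋆♭ = (60800ℓ²L)⁻¹`, `ℓ = (d+2)L`.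

WHAT THIS FILE PROVES: ★★ `norm_chartLogFlat_sub_lin_le` (every admissible family `Adm22 D R′ M`, `2L ≤ R′`, `1 ≤ M`, `D.k = K − n`, level weights; `η = L^{−(K−n)}`):
`(∀ b, w 1 b·‖A b‖ ≤ δ) → δ < R⋆♭∕4 → ∀ (j,c), ‖chartLogFlat η D A (j,c) − ((η:ℂ)·Lʲ) • Q_j A c‖ ≤ (64L∕R⋆♭)·δ²`, and the function-level form
`chartLogFlat_eq_lin_add_remainder` (`Q♭(A) = Qlin A + C♭(A)` with the same bound on `C♭(A) := Q♭(A) − Qlin A`, `Qlin := fderiv ℂ Q♭ 0`).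
HONEST SCOPE: a corollary of the cell's B1–B3 + CERT-2; NOT a claim about the stub, the crux, the rung or the mass gap.

References: T. Bałaban, CMP **102** (1985) 277–309 [Balaban1985Variational] ((20) p.281, (44) p.285, (152) p.301); CMP **98** (1985) 17–51 [Balaban1985Averaging]
(Prop. 4 (134)–(135) p.38); CMP **99** (1985) 389–434 [Balaban1985RegularSpaces] ((1.33)–(1.36)).
-/

set_option autoImplicit false

noncomputable section

open scoped BigOperators Matrix.Norms.L2Operator

namespace Summit.QuantumFields.YangMills.Theorems.Prop8ChartDoubleBar

open Literature.MathematicalPhysics.QuantumFieldTheory.Balaban1983to89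
open LatticeFieldCalculus (bondAvgIter)
open B6SectADomainsV1 (Domains)
open B6SectAOperatorsV1 (BondIdx)
open T3ContinuumYM3Torus (T3Family)
open Summit.QuantumFields.YangMills.Theorems.FlatCubeOpsText (Adm22 IsLevWeight)

/-- **(44) FOR THE DOUBLE-BAR CHART WITH THE LINEAR PART WRITTEN OUT**: for an admissible family and `A` of level-weighted size `≤ δ < R⋆♭∕4` (`R⋆♭ = (16·3800·ℓ²·L)⁻¹`):
`‖Q♭(A)(j,c) − (η·Lʲ)•Q_j A(c)‖ ≤ (64L∕R⋆♭)·δ²` at every index `(j,c)`, `η = L^{−(K−n)}` — k-UNIFORM.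
[cite: Balaban1985Variational, (44) p.285, (152) p.301; Balaban1985Averaging, Prop. 4 (134)-(135) p.38] -/
theorem norm_chartLogFlat_sub_lin_le (F : T3Family) (n K : ℕ) {R' M : ℕ} (hR'L : 2 * (F.P K).L ≤ R') (hM : 1 ≤ M) (D : Domains (F.P K))
    (hDk : D.k = K - n) (hAdm : Adm22 D R' M) {w : ℕ → PBond (F.P K) 0 → ℝ} (hw : IsLevWeight F n K D w)
    (A : PBond (F.P K) 0 → Matrix (Fin 2) (Fin 2) ℂ) {δ : ℝ}
    (hδ : δ < (16 * 3800 * ((((F.P K).d + 2) * (F.P K).L : ℕ) : ℝ) ^ 2 * (F.L : ℝ))⁻¹ / 4) (hA : ∀ b, w 1 b * ‖A b‖ ≤ δ) (idx : BondIdx D) :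
    ‖chartLogFlat (((F.L : ℝ)⁻¹) ^ (K - n)) D A idx -
        (((((F.L : ℝ)⁻¹) ^ (K - n) : ℝ) : ℂ) * ((F.L : ℂ)) ^ (idx.1.1 : ℕ)) • bondAvgIter (idx.1.1 : ℕ) A idx.1.2‖ ≤
      (64 * (F.L : ℝ) / (16 * 3800 * ((((F.P K).d + 2) * (F.P K).L : ℕ) : ℝ) ^ 2 * (F.L : ℝ))⁻¹) * δ ^ 2 := by
  have h := (chartRemainderFlat_hCd_hCq_B1 F n K hR'L hM D hDk hAdm hw).2 A δ hδ hA idx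
  rw [fderiv_chartLogFlat_zero_apply] at h
  have hL : (((F.P K).L : ℕ) : ℂ) = ((F.L : ℝ) : ℂ) := by norm_cast
  simpa only [hL, Complex.ofReal_natCast] using h

/-- **THE DECOMPOSITION `Q♭ = Qlin + C♭` WITH THE k-UNIFORM QUADRATIC BOUND ON `C♭`** (`Qlin := fderiv ℂ Q♭ 0`, `C♭ := Q♭ − Qlin`): for every admissible family and every `A`
of level-weighted size `≤ δ < R⋆♭∕4`, `Q♭(A) = Qlin A + C♭(A)` and `‖C♭(A)(j,c)‖ ≤ (64L∕R⋆♭)·δ²`. [cite: Balaban1985Variational, (44)-(48) p.285] -/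
theorem chartLogFlat_eq_lin_add_remainder (F : T3Family) (n K : ℕ) {R' M : ℕ} (hR'L : 2 * (F.P K).L ≤ R') (hM : 1 ≤ M) (D : Domains (F.P K))
    (hDk : D.k = K - n) (hAdm : Adm22 D R' M) {w : ℕ → PBond (F.P K) 0 → ℝ} (hw : IsLevWeight F n K D w)
    (A : PBond (F.P K) 0 → Matrix (Fin 2) (Fin 2) ℂ) {δ : ℝ}
    (hδ : δ < (16 * 3800 * ((((F.P K).d + 2) * (F.P K).L : ℕ) : ℝ) ^ 2 * (F.L : ℝ))⁻¹ / 4) (hA : ∀ b, w 1 b * ‖A b‖ ≤ δ) :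
    chartLogFlat (((F.L : ℝ)⁻¹) ^ (K - n)) D A =
        (fderiv ℂ (chartLogFlat (((F.L : ℝ)⁻¹) ^ (K - n)) D :
          (PBond (F.P K) 0 → Matrix (Fin 2) (Fin 2) ℂ) → BondIdx D → Matrix (Fin 2) (Fin 2) ℂ) 0) A +
        (chartLogFlat (((F.L : ℝ)⁻¹) ^ (K - n)) D A -
          (fderiv ℂ (chartLogFlat (((F.L : ℝ)⁻¹) ^ (K - n)) D :
            (PBond (F.P K) 0 → Matrix (Fin 2) (Fin 2) ℂ) → BondIdx D → Matrix (Fin 2) (Fin 2) ℂ) 0) A) ∧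
      ∀ idx : BondIdx D,
        ‖(chartLogFlat (((F.L : ℝ)⁻¹) ^ (K - n)) D A -
            (fderiv ℂ (chartLogFlat (((F.L : ℝ)⁻¹) ^ (K - n)) D :
              (PBond (F.P K) 0 → Matrix (Fin 2) (Fin 2) ℂ) → BondIdx D → Matrix (Fin 2) (Fin 2) ℂ) 0) A) idx‖ ≤
          (64 * (F.L : ℝ) / (16 * 3800 * ((((F.P K).d + 2) * (F.P K).L : ℕ) : ℝ) ^ 2 * (F.L : ℝ))⁻¹) * δ ^ 2 :=
  ⟨(add_sub_cancel _ _).symm, fun idx => by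
    rw [Pi.sub_apply]
    exact (chartRemainderFlat_hCd_hCq_B1 F n K hR'L hM D hDk hAdm hw).2 A δ hδ hA idx⟩

end Summit.QuantumFields.YangMills.Theorems.Prop8ChartDoubleBar

end
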